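import Summits.Ventures.PercRepro.AntipodalSMC

/-!
# The antipodal induction with a SUMMED step: `Σ_σ ΔΔ_g ≤ 0` on every sub-cube ⇒ `Q ≥ 0`

The antipodal SMC principle (`AntipodalSMC.lean`) needs the second difference of the kernel to be
nonpositive POINTWISE. For the C-005 kernel it is not (24 cover pairs), and for the lead's
liability-corrected kernel of C-011 it is not either (the shapes `(r⋖x)×(r⋖x)`, `(r⋖x)×(r⋖W)`), but the
inductive step only ever uses the SUM of the second differences over the antipodal pairs of a
sub-cube. This file isolates that exact combinatorial identity and the induction it drives:

* `antipodalPointSum S ω₀ F = Σ_σ F(ω₀[S:=σ], ω₀[S:=σ̄])` — the antipodal sum over the sub-cube `S`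
  of configurations (p4's `hbase` quantity);
* `secondDiffSum S ω₀ g F = Σ_σ [F(P¹,Q¹) − F(P¹,Q⁰) − F(P⁰,Q¹) + F(P⁰,Q⁰)]` with
  `P^b = ω₀[g:=b][S:=σ]`, `Q^b = ω₀[g:=b][S:=σ̄]`;
* **`antipodalPointSum_insert`** (exact, `g ∉ S`):
  `2·Σ_{S∪{g}} = Σ_{S, ω₀[g:=1]} + Σ_{S, ω₀[g:=0]} − secondDiffSum S ω₀ g F`
  — the cube is the two faces minus the defect;
* **`antipodalPointSum_nonneg_of_secondDiffSum`**: if `F(ω,ω) ≥ 0` and `secondDiffSum S ω₀ g F ≤ 0`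
  for every sub-cube `S`, base point `ω₀` and edge `g ∉ S`, then every antipodal point sum is
  nonnegative (induction on `S`), hence (p4's `antipodal_principle`) `Σ_{ω,ω'} w_p(ω)w_p(ω')F(ω,ω') ≥ 0`
  for every `p` (`dsum_nonneg_of_secondDiffSum`);
* for marked partitions: `MultiGraph.SummedStep A` (the step for the kernel `A` on every sub-cube
  of every finite multigraph) and **`MultiGraph.quadForm_nonneg_of_summedStep`**.

The summed step is the exact class-level (Bernstein-coefficient) form of the one-edge concavity
of the quadratic form. For the liability kernel of C-011 it is the lead's «step (ii)»: it holds on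
626,366 (graph, edge) pairs (n ≤ 7 small graphs, p6 second implementation) but it is FALSE in general
(`mining/p6/stepii/COUNTEREXAMPLE-stepii.md`: a 6-vertex, 8-edge two-hub multigraph with two edges of
summed second difference +2), while the product-level concavity is not refuted there — so
`SummedStep` is a strictly stronger hypothesis than edge-concavity, and this file provides the
identity and the induction, not a proof of C-011.
-/

namespace PercRepro

open Finset

section PointSums

variable {E : Type*} [Fintype E] [DecidableEq E]

/-- The antipodal sum of `F` over the sub-cube `S` of configurations, the other edges fixed to
`ω₀` (each antipodal pair of the sub-cube counted `2^{|E∖S|}` times, as in p4's `hbase`). -/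
def antipodalPointSum (S : Finset E) (ω₀ : Config E) (F : Config E → Config E → ℝ) : ℝ :=
  ∑ σ : Config E, F (patch S σ ω₀) (patch S (flipOn S σ) ω₀)

/-- The summed second difference along `g` over the antipodal pairs of the sub-cube `S`. -/
def secondDiffSum (S : Finset E) (ω₀ : Config E) (g : E) (F : Config E → Config E → ℝ) : ℝ :=
  ∑ σ : Config E,
    (F (patch S σ (Function.update ω₀ g true)) (patch S (flipOn S σ) (Function.update ω₀ g true)) -
      F (patch S σ (Function.update ω₀ g true)) (patch S (flipOn S σ) (Function.update ω₀ g false)) -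
      F (patch S σ (Function.update ω₀ g false)) (patch S (flipOn S σ) (Function.update ω₀ g true)) +
      F (patch S σ (Function.update ω₀ g false)) (patch S (flipOn S σ) (Function.update ω₀ g false)))

omit [Fintype E] in
/-- Patching `insert g S` is patching `S` into `ω₀[g := σ g]`. -/
theorem patch_insert {S : Finset E} {g : E} (hg : g ∉ S) (σ ω₀ : Config E) :
    patch (insert g S) σ ω₀ = patch S σ (Function.update ω₀ g (σ g)) := by
  funext e
  by_cases he : e = g
  · subst he
    simp [patch, hg]
  · simp [patch, he]

omit [Fintype E] in
/-- Patching `S` does not see the state of an edge outside `S`. -/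
theorem patch_update_config {S : Finset E} {g : E} (hg : g ∉ S) (σ ω₀ : Config E) (b : Bool) :
    patch S (Function.update σ g b) ω₀ = patch S σ ω₀ := by
  funext e
  by_cases he : e = g
  · subst he
    simp [patch, hg]
  · simp [patch, Function.update_of_ne he]

/-- **The cube is the two faces minus the defect** (`g ∉ S`):
`2 Σ_{S ∪ {g}} = Σ_{S, ω₀[g:=1]} + Σ_{S, ω₀[g:=0]} − secondDiffSum`. -/
theorem antipodalPointSum_insert {S : Finset E} {g : E} (hg : g ∉ S) (ω₀ : Config E)
    (F : Config E → Config E → ℝ) :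
    2 * antipodalPointSum (insert g S) ω₀ F =
      antipodalPointSum S (Function.update ω₀ g true) F +
        antipodalPointSum S (Function.update ω₀ g false) F - secondDiffSum S ω₀ g F := by
  -- the two mixed terms, as functions of σ invariant under flipping g
  set P1 : Config E → ℝ := fun σ =>
    F (patch S σ (Function.update ω₀ g true)) (patch S (flipOn S σ) (Function.update ω₀ g false))
  set P0 : Config E → ℝ := fun σ =>
    F (patch S σ (Function.update ω₀ g false)) (patch S (flipOn S σ) (Function.update ω₀ g true))
  have hP1 : ∀ σ, P1 (flipEdge g σ) = P1 σ := by
    intro σ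
    simp only [P1, flipEdge, patch_update_config hg, flipOn_update hg]
  have hP0 : ∀ σ, P0 (flipEdge g σ) = P0 σ := by
    intro σ
    simp only [P0, flipEdge, patch_update_config hg, flipOn_update hg]
  have hcube : antipodalPointSum (insert g S) ω₀ F =
      ∑ σ : Config E, (if σ g then P1 σ else P0 σ) := by
    unfold antipodalPointSum
    refine Finset.sum_congr rfl fun σ _ => ?_
    rw [patch_insert hg, patch_insert hg, flipOn_insert, patch_update_config hg,
      Function.update_self]
    cases σ g <;> simp [P1, P0]
  have hsplit : ∑ σ : Config E, (if σ g then P1 σ else P0 σ) =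
      ∑ σ : Config E, (if σ g then P1 σ else 0) + ∑ σ : Config E, (if σ g then (0 : ℝ) else P0 σ) := by
    rw [← Finset.sum_add_distrib]
    refine Finset.sum_congr rfl fun σ _ => ?_
    cases σ g <;> simp
  have h1 := sum_eq_two_mul_sum_of_flip_invariant g P1 hP1
  have h0 := sum_eq_two_mul_sum_of_flip_invariant' g P0 hP0
  have hmixed : 2 * antipodalPointSum (insert g S) ω₀ F = ∑ σ : Config E, (P1 σ + P0 σ) := by
    rw [hcube, hsplit, mul_add, ← h1, ← h0, Finset.sum_add_distrib]
  rw [hmixed]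
  unfold antipodalPointSum secondDiffSum
  simp only [← Finset.sum_add_distrib, ← Finset.sum_sub_distrib]
  refine Finset.sum_congr rfl fun σ _ => ?_
  simp only [P1, P0]
  ring

/-- **The antipodal induction with a summed step**: if the diagonal of `F` is nonnegative and the
summed second difference is nonpositive on every sub-cube, every antipodal point sum is
nonnegative. -/
theorem antipodalPointSum_nonneg_of_secondDiffSum (F : Config E → Config E → ℝ)
    (hdiag : ∀ ω, 0 ≤ F ω ω)
    (hstep : ∀ (S : Finset E) (ω₀ : Config E) (g : E), g ∉ S → secondDiffSum S ω₀ g F ≤ 0)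
    (S : Finset E) : ∀ ω₀ : Config E, 0 ≤ antipodalPointSum S ω₀ F := by
  induction S using Finset.induction_on with
  | empty =>
    intro ω₀
    unfold antipodalPointSum
    refine Finset.sum_nonneg fun σ _ => ?_
    have h : ∀ τ : Config E, patch ∅ τ ω₀ = ω₀ := fun τ => by funext e; simp [patch]
    rw [h, h]
    exact hdiag ω₀
  | insert g S hg ih =>
    intro ω₀
    have h := antipodalPointSum_insert hg ω₀ F
    have h1 := ih (Function.update ω₀ g true)
    have h0 := ih (Function.update ω₀ g false)
    have hs := hstep S ω₀ g hg
    linarith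

/-- The quadratic form of `F` is nonnegative for every probability vector once the summed step
holds on every sub-cube (through p4's antipodal principle). -/
theorem dsum_nonneg_of_secondDiffSum (F : Config E → Config E → ℝ)
    (hdiag : ∀ ω, 0 ≤ F ω ω)
    (hstep : ∀ (S : Finset E) (ω₀ : Config E) (g : E), g ∉ S → secondDiffSum S ω₀ g F ≤ 0)
    {p : E → ℝ} (hp : IsProb p) : 0 ≤ dsum (weight p) (weight p) F :=
  antipodal_principle F (fun S ω₀ => antipodalPointSum_nonneg_of_secondDiffSum F hdiag hstep S ω₀) hp

end PointSums

/-! ### Marked partitions: the summed step as a named hypothesis on a kernel -/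

namespace MultiGraph

variable {V E : Type*} (G : MultiGraph V E) [Fintype E] [DecidableEq E]

/-- The summed second difference of a partition kernel along `g` over the antipodal pairs of the
sub-cube `S` (base point `ω₀`) of the marked partition of `G`. -/
noncomputable def kernelStep {k : ℕ} (m : Fin k → V) (A : Setoid (Fin k) → Setoid (Fin k) → ℝ)
    (S : Finset E) (ω₀ : Config E) (g : E) : ℝ :=
  secondDiffSum S ω₀ g fun ω ω' => A (G.markedPartition ω m) (G.markedPartition ω' m)

end MultiGraph

/-- **The summed step for a kernel `A`** on `k` marked vertices, as a named Prop: on every sub-cube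
of every finite multigraph the summed second difference of `A ∘ (Π, Π)` along every free edge is
nonpositive. For the liability kernel of C-011 this is the lead's step (ii). -/
def SummedStep {k : ℕ} (A : Setoid (Fin k) → Setoid (Fin k) → ℝ) : Prop :=
  ∀ {V E : Type} [Fintype E] [DecidableEq E] (G : MultiGraph V E) (m : Fin k → V)
    (S : Finset E) (ω₀ : Config E) (g : E), g ∉ S → G.kernelStep m A S ω₀ g ≤ 0

namespace MultiGraph

variable {V E : Type} (G : MultiGraph V E) [Fintype E] [DecidableEq E]

/-- **Quadratic forms from the summed step**: a kernel with nonnegative diagonal satisfying the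
summed step has a nonnegative quadratic form at the law of the marked partition, for every finite
multigraph, every `p ∈ [0,1]^E` and every marking. -/
theorem quadForm_nonneg_of_summedStep {k : ℕ} (m : Fin k → V)
    {A : Setoid (Fin k) → Setoid (Fin k) → ℝ} (hdiag : ∀ σ, 0 ≤ A σ σ) (hstep : SummedStep A)
    {p : E → ℝ} (hp : IsProb p) : 0 ≤ G.quadForm p m A := by
  rw [quadForm_eq_dsum]
  exact dsum_nonneg_of_secondDiffSum _ (fun ω => hdiag _)
    (fun S ω₀ g hg => hstep G m S ω₀ g hg) hp

/-- The summed step is implied by the pointwise SMC condition (so the SMC principle is the special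
case of the summed-step principle). -/
theorem summedStep_of_smc {k : ℕ} {A : Setoid (Fin k) → Setoid (Fin k) → ℝ} (hA : SMC A) :
    SummedStep A := by
  intro V E _ _ G m S ω₀ g hg
  unfold kernelStep secondDiffSum
  refine Finset.sum_nonpos fun σ _ => ?_
  have h := G.smc_second_difference_nonpos m hA g
    (patch S σ (Function.update ω₀ g false)) (patch S (flipOn S σ) (Function.update ω₀ g false))
  -- with `g ∉ S`, the patched configuration with `ω₀[g:=b]` is the patched one with `ω₀[g:=false]`
  -- updated at `g`
  have e1 : ∀ τ : Config E, patch S τ (Function.update ω₀ g true) =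
      Function.update (patch S τ (Function.update ω₀ g false)) g true := by
    intro τ
    funext e
    by_cases he : e = g
    · subst he
      simp [patch, hg]
    · simp [patch, Function.update_of_ne he]
  have e0 : ∀ τ : Config E, Function.update (patch S τ (Function.update ω₀ g false)) g false =
      patch S τ (Function.update ω₀ g false) := by
    intro τ
    funext e
    by_cases he : e = g
    · subst he
      simp [patch, hg]
    · simp [Function.update_of_ne he]
  rw [e0 σ, e0 (flipOn S σ)] at h
  rw [e1 σ, e1 (flipOn S σ)]
  exact h

end MultiGraph

end PercRepro
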